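import Literature.Geometry.Riemannian.CurvatureScale
import Literature.Geometry.Riemannian.HeatKernelGaussianBound
import HarnessLib

/-!
# Bamler's ε-regularity theorem (Bamler 2020a, Thm. 10.2) — statement

R. Bamler, *Entropy and heat kernel bounds on a Ricci flow background*, arXiv:2008.07093 (2020a),
§10.1, Thm. 10.2 (arXiv v1 Thm. 39): "There is a constant `ε(n) > 0` such that the following
holds. Consider a point `(x, t) ∈ M × I`, `r > 0` with `[t − r², t] ⊂ I`. If `𝒩_{x,t}(r²) ≥ −ε`,
then `r_Rm(x, t) ≥ ε r`." Here `(M, (g_t)_{t ∈ I})` is a Ricci flow on a compact `n`-manifold,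
`𝒩_{x,t}(τ)` the pointed Nash entropy of the conjugate heat kernel based at `(x, t)` (§5.1) and
`r_Rm` the curvature scale of Def. 10.1.

This file only STATES the theorem, in the tree's vocabulary (`IsRicciFlow`, `heatKernelFn`,
`pointedNashEntropy`, `curvatureScale`), as the named fact `bamler_epsilonRegularity`; its proof
in the source is a blow-up argument (point picking — in the tree: `exists_point_picking_conventional`
— limits of pointed flows, rigidity of the bounded-curvature gradient shrinking soliton that
arises, and Perelman's pseudolocality theorem), whose compactness and pseudolocality inputs are
not in the tree. Users take `(h : bamler_epsilonRegularity)`; the consumed form (an admissible radius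
`ε r / 2`, i.e. `|Rm| ≤ (ε r/2)⁻²` on `P(x,t; ε r/2)`) is `curvatureScaleAdmissible_of_bamler_epsilonRegularity`.

## References

* R. H. Bamler, *Entropy and heat kernel bounds on a Ricci flow background*, arXiv:2008.07093
  (2020), §10.1 Thm. 10.2 (arXiv v1 Thm. 39); §10.2 (proof). [Bamler2020Entropy]
-/

noncomputable section

open Set
open scoped Manifold ContDiff Topology ENNReal NNReal

namespace Literature.Geometry.Riemannian

open Lorentzian Lorentzian.PseudoRiemannianMetric

/-- NAMED FACT (**Bamler 2020a, Thm. 10.2 / arXiv v1 Thm. 39, ε-regularity**): for every `m ≥ 3`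
there is `ε > 0` such that for every Ricci flow `(h, cov)` on `[a, T]` of a smooth family of
Riemannian metrics on a closed connected `m`-manifold `M` (modelled on `ℝᵐ`), every `x ∈ M`,
`t ≤ T` and `r > 0` with `a < t − r²`: if the pointed Nash entropy of the conjugate heat kernel
based at `(x, t)` satisfies `𝒩_{x,t}(r²) ≥ −ε`, then the curvature scale satisfies
`r_Rm(x, t) ≥ ε r` (`curvatureScale`, Def. 10.1, frame sense, over the time set `[a, T]`).
Special case of the source (which allows any interval `I ∋ [t − r², t]` and dimension `n ≥ 1`;
the tree's heat kernel is built for closed connected manifolds and `m ≥ 3` is the standing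
hypothesis of its entropy estimates).
-- TODO(general form): arbitrary `I ⊇ [t − r², t]`, all `n`.
[cite: Bamler2020Entropy, §10.1, Thm. 10.2 (arXiv v1 Thm. 39)] -/
def bamler_epsilonRegularity : Prop :=
  ∀ (m : ℕ), 3 ≤ m → ∃ ε : ℝ, 0 < ε ∧
    ∀ (M : Type) [TopologicalSpace M] [ChartedSpace (EuclideanSpace ℝ (Fin m)) M]
      [IsManifold 𝓘(ℝ, EuclideanSpace ℝ (Fin m)) ∞ M] [T2Space M] [CompactSpace M]
      [SecondCountableTopology M] [MeasurableSpace M] [BorelSpace M] [ConnectedSpace M]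
      (h : ℝ → PseudoRiemannianMetric 𝓘(ℝ, EuclideanSpace ℝ (Fin m)) ∞ (EuclideanSpace ℝ (Fin m))
        (TangentSpace 𝓘(ℝ, EuclideanSpace ℝ (Fin m)) : M → Type _))
      (cov : ℝ → CovariantDerivative 𝓘(ℝ, EuclideanSpace ℝ (Fin m)) (EuclideanSpace ℝ (Fin m))
        (TangentSpace 𝓘(ℝ, EuclideanSpace ℝ (Fin m)) : M → Type _))
      (a T : ℝ) (hflow : IsRicciFlow h cov (Icc a T)) (hh : IsContMDiffFamilyOn ∞ h univ)
      (hR : ∀ s, (h s).IsRiemannian) (x : M) (t r : ℝ), 0 < r → a < t - r ^ 2 → t ≤ T →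
      -ε ≤ pointedNashEntropy h (fun r' v ↦ hflow.heatKernelFn hh hR t x (v, r')) m t (t - r ^ 2) →
      ENNReal.ofReal (ε * r) ≤ curvatureScale h cov (Icc a T) hR x t


/-- **Consequence (conditional on the fact): curvature control below the scale `ε r`.** Under
`bamler_epsilonRegularity`, for `m ≥ 3` there is `ε > 0` such that, in the setting of the fact,
`𝒩_{x,t}(r²) ≥ −ε` makes the radius `ε r / 2` admissible at `(x, t)`: `|Rm| ≤ (ε r/2)⁻²` on the
conventional neighbourhood `P(x, t; ε r/2)` (`CurvatureScaleAdmissible`; from `r_Rm(x,t) ≥ ε r > ε r/2`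
and `curvatureScaleAdmissible_of_ofReal_lt_curvatureScale`). This is the form in which the
ε-regularity theorem is consumed. [cite: Bamler2020Entropy, §10.1, Thm. 10.2] -/
theorem curvatureScaleAdmissible_of_bamler_epsilonRegularity (hreg : bamler_epsilonRegularity)
    (m : ℕ) (hm : 3 ≤ m) : ∃ ε : ℝ, 0 < ε ∧
    ∀ (M : Type) [TopologicalSpace M] [ChartedSpace (EuclideanSpace ℝ (Fin m)) M]
      [IsManifold 𝓘(ℝ, EuclideanSpace ℝ (Fin m)) ∞ M] [T2Space M] [CompactSpace M]
      [SecondCountableTopology M] [MeasurableSpace M] [BorelSpace M] [ConnectedSpace M]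
      (h : ℝ → PseudoRiemannianMetric 𝓘(ℝ, EuclideanSpace ℝ (Fin m)) ∞ (EuclideanSpace ℝ (Fin m))
        (TangentSpace 𝓘(ℝ, EuclideanSpace ℝ (Fin m)) : M → Type _))
      (cov : ℝ → CovariantDerivative 𝓘(ℝ, EuclideanSpace ℝ (Fin m)) (EuclideanSpace ℝ (Fin m))
        (TangentSpace 𝓘(ℝ, EuclideanSpace ℝ (Fin m)) : M → Type _))
      (a T : ℝ) (hflow : IsRicciFlow h cov (Icc a T)) (hh : IsContMDiffFamilyOn ∞ h univ)
      (hR : ∀ s, (h s).IsRiemannian) (x : M) (t r : ℝ), 0 < r → a < t - r ^ 2 → t ≤ T →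
      -ε ≤ pointedNashEntropy h (fun r' v ↦ hflow.heatKernelFn hh hR t x (v, r')) m t (t - r ^ 2) →
      CurvatureScaleAdmissible h cov (Icc a T) hR x t (ε * r / 2) := by
  obtain ⟨ε, hε, hreg⟩ := hreg m hm
  refine ⟨ε, hε, ?_⟩
  intro M _ _ _ _ _ _ _ _ _ h cov a T hflow hh hR x t r hr hat htT hN
  have hscale := hreg M h cov a T hflow hh hR x t r hr hat htT hN
  have hεr : 0 < ε * r / 2 := by positivity
  refine curvatureScaleAdmissible_of_ofReal_lt_curvatureScale hεr (lt_of_lt_of_le ?_ hscale)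
  exact (ENNReal.ofReal_lt_ofReal_iff (by positivity)).2 (by linarith [mul_pos hε hr])

end Literature.Geometry.Riemannian

end
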